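import Summits.Ventures.DiscreteObjects.Hadamard.FixedBlockIntertwiningPackage
import Summits.Ventures.DiscreteObjects.Hadamard.ConferenceGraph333FixedBlockOrthogonal

/-!
# The sign-character test at the extremal fixed subgraphs of orders `11`, `7`, `5`, `3` of srg(333,166,82,83) (kernel instances)

Framing: lottery ticket; floor = certified bounds/negative ranges.  Cell pub-namedobj (venture DiscreteObjects),
target (H) = `H(668)`, hadamard gen 32.  INSTANCES of `FixedBlockIntertwiningPackage.fixedBlock_commuting_sign_test` (the multiplicity of the sign
character of `⟨σ⟩` on `ker B` is non-negative) at the conference-type fixed subgraphs of `ConferenceGraph333FixedBlockOrthogonal`, for an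
automorphism `σ` of EVEN order `N` commuting with `ρ`; notation `T_j = #{x : ρx ≠ x, σʲx ∈ ⟨ρ⟩x}`, `f_j = #{x : σʲx = x, ρx = x}`:
* **`aut_order11_sign_test`** (`ρ^11 = 1`, `ρ ≠ 1`): `0 ≤ Σ_{j<N} (−1)ʲ (T_j − 11 f_j)`;
* **`aut_order7_fixed25_sign_test`** (`ρ^7 = 1`, `#Fix ρ = 25`): `0 ≤ Σ_{j<N} (−1)ʲ (T_j − 7 f_j)`;
* `aut_order5_fixed13_sign_test`, `aut_order3_fixed9_sign_test` likewise.
E2: kills e.g. the order-42 types with χ = (19,1,−11,7,−11,1), (19,1,−11,19,−11,1), (19,3,−5,15,−5,3) (sign sums −84, −168, −84) of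
pub-namedobj-hadamard-g31/results/rank_test_general_g31.txt.  WORDS: structure of a HYPOTHETICAL object; ours (PROVISIONAL).
No `sorry`, no new definitions.
-/

namespace Summit.Ventures.DiscreteObjects.Hadamard

open Finset

section signTests
variable {V : Type*} [Fintype V] [DecidableEq V]

/-- **Sign test at order `11`.** -/
theorem aut_order11_sign_test (hV : Fintype.card V = 333) (A : Matrix V V ℤ)
    (h01 : ∀ x y, A x y = 0 ∨ A x y = 1) (hsymm : ∀ x y, A y x = A x y) (hdiag : ∀ x, A x x = 0)
    (hk : ∀ x, ∑ y, A x y = 166) (hsrg : ∀ x y, ∑ z, A x z * A z y = 83 * (1 + (if x = y then 1 else 0)) - A x y)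
    (ρ : Equiv.Perm V) (hρ : ρ ^ 11 = 1) (hρ1 : ρ ≠ 1) (hAρ : ∀ x y, A (ρ x) (ρ y) = A x y)
    (σ : Equiv.Perm V) (hc : σ * ρ = ρ * σ) (hAσ : ∀ x y, A (σ x) (σ y) = A x y)
    {N : ℕ} (hN : 0 < N) (hNe : Even N) (hσN : σ ^ N = 1) :
    0 ≤ ∑ j ∈ Finset.range N, (-1 : ℤ) ^ j *
      ((((univ.filter fun x => ρ x ≠ x ∧ (σ ^ j) x ∈ (Finset.range 11).image (fun k => (ρ ^ k) x)).card : ℤ)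
        - 11 * ((univ.filter fun x => (σ ^ j) x = x ∧ ρ x = x).card : ℤ))) := by
  obtain ⟨-, -, hblk1, hblk2, -⟩ := aut_order11_fixed_block hV A h01 hsymm hdiag hk hsrg ρ hρ hρ1 hAρ
  have h := fixedBlock_commuting_sign_test A h01 hsymm (by norm_num : Nat.Prime 11) ρ hρ hAρ (K := 77) (by norm_num)
    (fun y hy => by rw [(hblk1 y hy).1]; norm_num) (fun y hy y' hy' hne => (hblk2 y hy y' hy' hne).1) σ hc hAσ hN hNe hσN
  exact_mod_cast h

/-- **Sign test at order `7` with `25` fixed vertices.** -/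
theorem aut_order7_fixed25_sign_test (hV : Fintype.card V = 333) (A : Matrix V V ℤ)
    (h01 : ∀ x y, A x y = 0 ∨ A x y = 1) (hsymm : ∀ x y, A y x = A x y) (hdiag : ∀ x, A x x = 0)
    (hk : ∀ x, ∑ y, A x y = 166) (hsrg : ∀ x y, ∑ z, A x z * A z y = 83 * (1 + (if x = y then 1 else 0)) - A x y)
    (ρ : Equiv.Perm V) (hρ : ρ ^ 7 = 1) (hAρ : ∀ x y, A (ρ x) (ρ y) = A x y) (hf : (univ.filter fun x => ρ x = x).card = 25)
    (σ : Equiv.Perm V) (hc : σ * ρ = ρ * σ) (hAσ : ∀ x y, A (σ x) (σ y) = A x y)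
    {N : ℕ} (hN : 0 < N) (hNe : Even N) (hσN : σ ^ N = 1) :
    0 ≤ ∑ j ∈ Finset.range N, (-1 : ℤ) ^ j *
      ((((univ.filter fun x => ρ x ≠ x ∧ (σ ^ j) x ∈ (Finset.range 7).image (fun k => (ρ ^ k) x)).card : ℤ)
        - 7 * ((univ.filter fun x => (σ ^ j) x = x ∧ ρ x = x).card : ℤ))) := by
  obtain ⟨hblk1, hblk2⟩ := aut_order7_fixed25_block hV A h01 hsymm hdiag hk hsrg ρ hρ hAρ hf
  have h := fixedBlock_commuting_sign_test A h01 hsymm (by norm_num : Nat.Prime 7) ρ hρ hAρ (K := 77) (by norm_num)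
    (fun y hy => by rw [(hblk1 y hy).1]; norm_num) (fun y hy y' hy' hne => (hblk2 y hy y' hy' hne).1) σ hc hAσ hN hNe hσN
  exact_mod_cast h

/-- **Sign test at order `5` with `13` fixed vertices.** -/
theorem aut_order5_fixed13_sign_test (hV : Fintype.card V = 333) (A : Matrix V V ℤ)
    (h01 : ∀ x y, A x y = 0 ∨ A x y = 1) (hsymm : ∀ x y, A y x = A x y) (hdiag : ∀ x, A x x = 0)
    (hk : ∀ x, ∑ y, A x y = 166) (hsrg : ∀ x y, ∑ z, A x z * A z y = 83 * (1 + (if x = y then 1 else 0)) - A x y)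
    (ρ : Equiv.Perm V) (hρ : ρ ^ 5 = 1) (hAρ : ∀ x y, A (ρ x) (ρ y) = A x y) (hf : (univ.filter fun x => ρ x = x).card = 13)
    (σ : Equiv.Perm V) (hc : σ * ρ = ρ * σ) (hAσ : ∀ x y, A (σ x) (σ y) = A x y)
    {N : ℕ} (hN : 0 < N) (hNe : Even N) (hσN : σ ^ N = 1) :
    0 ≤ ∑ j ∈ Finset.range N, (-1 : ℤ) ^ j *
      ((((univ.filter fun x => ρ x ≠ x ∧ (σ ^ j) x ∈ (Finset.range 5).image (fun k => (ρ ^ k) x)).card : ℤ)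
        - 5 * ((univ.filter fun x => (σ ^ j) x = x ∧ ρ x = x).card : ℤ))) := by
  obtain ⟨hblk1, hblk2⟩ := aut_order5_fixed13_block hV A h01 hsymm hdiag hk hsrg ρ hρ hAρ hf
  have h := fixedBlock_commuting_sign_test A h01 hsymm (by norm_num : Nat.Prime 5) ρ hρ hAρ (K := 80) (by norm_num)
    (fun y hy => by rw [(hblk1 y hy).1]; norm_num) (fun y hy y' hy' hne => (hblk2 y hy y' hy' hne).1) σ hc hAσ hN hNe hσN
  exact_mod_cast h

/-- **Sign test at order `3` with `9` fixed vertices.** -/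
theorem aut_order3_fixed9_sign_test (hV : Fintype.card V = 333) (A : Matrix V V ℤ)
    (h01 : ∀ x y, A x y = 0 ∨ A x y = 1) (hsymm : ∀ x y, A y x = A x y) (hdiag : ∀ x, A x x = 0)
    (hk : ∀ x, ∑ y, A x y = 166) (hsrg : ∀ x y, ∑ z, A x z * A z y = 83 * (1 + (if x = y then 1 else 0)) - A x y)
    (ρ : Equiv.Perm V) (hρ : ρ ^ 3 = 1) (hAρ : ∀ x y, A (ρ x) (ρ y) = A x y) (hf : (univ.filter fun x => ρ x = x).card = 9)
    (σ : Equiv.Perm V) (hc : σ * ρ = ρ * σ) (hAσ : ∀ x y, A (σ x) (σ y) = A x y)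
    {N : ℕ} (hN : 0 < N) (hNe : Even N) (hσN : σ ^ N = 1) :
    0 ≤ ∑ j ∈ Finset.range N, (-1 : ℤ) ^ j *
      ((((univ.filter fun x => ρ x ≠ x ∧ (σ ^ j) x ∈ (Finset.range 3).image (fun k => (ρ ^ k) x)).card : ℤ)
        - 3 * ((univ.filter fun x => (σ ^ j) x = x ∧ ρ x = x).card : ℤ))) := by
  obtain ⟨hblk1, hblk2⟩ := aut_order3_fixed9_block hV A h01 hsymm hdiag hk hsrg ρ (e := 1) (by simpa using hρ) hAρ hf
  have h := fixedBlock_commuting_sign_test A h01 hsymm (by norm_num : Nat.Prime 3) ρ hρ hAρ (K := 81) (by norm_num)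
    (fun y hy => by rw [(hblk1 y hy).1]; norm_num) (fun y hy y' hy' hne => (hblk2 y hy y' hy' hne).1) σ hc hAσ hN hNe hσN
  exact_mod_cast h

end signTests

end Summit.Ventures.DiscreteObjects.Hadamard
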